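import Literature.Computability.Complexity.FoldCatBricks
import Literature.Computability.Complexity.PlumbingBricks
import Literature.Computability.Complexity.UnaryOffsets
import Literature.Computability.Complexity.StringEquality
import Literature.Computability.Complexity.FPStringBricks
import Literature.Computability.Complexity.IsqrtBrick
import HarnessLib

/-!
# Upper-triangle bricks: cleaning a square bit matrix into a loop-free symmetric code is in `FP`

Trunk `CplxCore`, toolkit in the `FP` string-algebra style of `BrickAlgebra.lean` /
`FoldCatBricks.lean` / `GraphSwapBricks.lean` (records, `fanoutFn`, `iteFn`, `takeFn`/`dropFn`,
the concatenation fold `Brick.foldCat`), written for the slice plumbing of negation-limited circuit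
lower bounds (`Summits/PneNP/PneNP/Theorems/NegLimitedLoglogSlices.lean`: an explicit language in
`P` whose slices at square lengths are Tardos's clique-like function of the upper triangle).

* `UpperTriangle.entry u m t` — the entry at row-major position `t` (`(a, b) = (t / m, t mod m)`)
  of the CLEANED matrix of an `m × m` bit matrix `u`: `0` on the diagonal, else the NEGATED entry of
  `u` at the upper-triangle position `min a b · m + max a b` (so the cleaned matrix is symmetric with
  zero diagonal and depends only on the strict upper triangle of `u`; the negation makes it the
  complement code `complCode` of the graph read off the upper triangle, cf. `TardosComplementCode`).
* **`UpperTriangle.cleanFn ∈ FP`** (`cleanFn_mem_FP`) with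
  **`cleanFn u = (entry u m t)_{t < m²}`** whenever `|u| = m²` (`cleanFn_sq`): a `foldCat` over the
  positions whose piece function is assembled from the carrying counter `Plumb.divModFn`
  (`t ↦ (t / m, t mod m)`), `takeFn`/`dropFn` (min / max of two unary numbers), the unary product
  `UnaryOffsets.mulLenFn` (offset `min · m`), `bitAtFn` and the equality test `eqPairFn`; the side
  `m = ⌊√|u|⌋` is supplied by `isqrtFn`/`binToUnaryFn`.

## References

* S. Arora, B. Barak, *Computational Complexity: A Modern Approach*, CUP 2009, §0.1 (adjacency
  matrix codes), §1.3 (polynomial time is closed under composition and bounded loops).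
-/

namespace Literature.Computability.Complexity

open _root_.Computability Polynomial Brick

namespace UpperTriangle

/-- The entry of the cleaned matrix at position `t` (`(a, b) = (t / m, t mod m)`): `0` on the
diagonal, else the negated entry of `u` at the upper-triangle position `min · m + max`.
[folklore] -/
def entry (u : List Bool) (m t : ℕ) : Bool :=
  if t / m = t % m then false else !u.getD (min (t / m) (t % m) * m + max (t / m) (t % m)) false

/-- The upper-triangle position stays inside the square. [folklore] -/
private theorem triPos_lt {m t : ℕ} (ht : t < m * m) :
    min (t / m) (t % m) * m + max (t / m) (t % m) < m * m := by
  have hm : 0 < m := Nat.pos_of_ne_zero (by rintro rfl; simp at ht)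
  have h1 : t % m < m := Nat.mod_lt _ hm
  have h2 : t / m < m := Nat.div_lt_of_lt_mul ht
  have h3 : min (t / m) (t % m) ≤ m - 1 := by omega
  have h4 : max (t / m) (t % m) ≤ m - 1 := by omega
  calc min (t / m) (t % m) * m + max (t / m) (t % m) ≤ (m - 1) * m + (m - 1) :=
        Nat.add_le_add (Nat.mul_le_mul_right _ h3) h4
    _ < m * m := by
      obtain ⟨k, rfl⟩ : ∃ k, m = k + 1 := ⟨m - 1, by omega⟩
      simp; nlinarith

noncomputable section

/-- The matrix `u` of a piece record `⟨⟨u, 1ᵐ⟩, 1ᵗ⟩`. [folklore] -/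
def zU : List Bool → List Bool := fstF ∘ fstF

/-- The side `1ᵐ` of a piece record. [folklore] -/
def zM : List Bool → List Bool := sndF ∘ fstF

/-- The position `1ᵗ` of a piece record. [folklore] -/
def zT : List Bool → List Bool := sndF

/-- `⟨1^{t / m}, 1^{t mod m}⟩` (the carrying counter `Plumb.divModFn`). [folklore] -/
def zRC : List Bool → List Bool := Plumb.divModFn ∘ fanoutFn zM zT

/-- The row `1^{t / m}`. [folklore] -/
def zR : List Bool → List Bool := fstF ∘ zRC

/-- The diagonal test `[t / m = t mod m]`. [folklore] -/
def zDiag : List Bool → List Bool := eqPairFn ∘ zRC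

/-- `1^{min (t/m) (t mod m)}` (`take`). [folklore] -/
def zMin : List Bool → List Bool := Plumb.takeFn ∘ zRC

/-- `1^{max (t/m) (t mod m)}` (`1^{t/m}` followed by what `drop` leaves of `1^{t mod m}`). [folklore] -/
def zMax : List Bool → List Bool := fun z => zR z ++ (Plumb.dropFn ∘ zRC) z

/-- A string of length `min · m + max` (the upper-triangle position, in unary). [folklore] -/
def zOff : List Bool → List Bool := fun z => (UnaryOffsets.mulLenFn ∘ fanoutFn zMin zM) z ++ zMax z

/-- The bit `u[min · m + max]`. [folklore] -/
def zBit : List Bool → List Bool := bitAtFn ∘ fanoutFn zOff zU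

/-- **The piece**: `0` on the diagonal, else `¬ u[min · m + max]`. [folklore] -/
def pieceFn : List Bool → List Bool := iteFn zDiag (fun _ => [false]) (notFn zBit)

/-- **The cleaning brick**: `u ↦ ccat_{t < |u|} pieceFn ⟨⟨u, 1^{⌊√|u|⌋}⟩, 1ᵗ⟩`.
[cite: AroraBarak2009, §1.3 (bounded loops)] -/
def cleanFn : List Bool → List Bool :=
  foldCat 1 X pieceFn ∘ fanoutFn (fanoutFn id (binToUnaryFn ∘ fanoutFn id isqrtFn)) id

/-- `zU ∈ FP`. [cite: AroraBarak2009, §1.3] -/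
private theorem zU_mem_FP : zU ∈ FP := comp_mem_FP fstF_mem_FP fstF_mem_FP
/-- `zM ∈ FP`. [cite: AroraBarak2009, §1.3] -/
private theorem zM_mem_FP : zM ∈ FP := comp_mem_FP sndF_mem_FP fstF_mem_FP
/-- `zT ∈ FP`. [cite: AroraBarak2009, §1.3] -/
private theorem zT_mem_FP : zT ∈ FP := sndF_mem_FP
/-- `zRC ∈ FP`. [cite: AroraBarak2009, §1.3] -/
private theorem zRC_mem_FP : zRC ∈ FP :=
  comp_mem_FP Plumb.divModFn_mem_FP (fanoutFn_mem_FP zM_mem_FP zT_mem_FP)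
/-- `zR ∈ FP`. [cite: AroraBarak2009, §1.3] -/
private theorem zR_mem_FP : zR ∈ FP := comp_mem_FP fstF_mem_FP zRC_mem_FP
/-- `zDiag ∈ FP`. [cite: AroraBarak2009, §1.3] -/
private theorem zDiag_mem_FP : zDiag ∈ FP := comp_mem_FP eqPairFn_mem_FP zRC_mem_FP
/-- `zMin ∈ FP`. [cite: AroraBarak2009, §1.3] -/
private theorem zMin_mem_FP : zMin ∈ FP := comp_mem_FP Plumb.takeFn_mem_FP zRC_mem_FP
/-- `zMax ∈ FP`. [cite: AroraBarak2009, §1.3] -/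
private theorem zMax_mem_FP : zMax ∈ FP := append_mem_FP zR_mem_FP (comp_mem_FP Plumb.dropFn_mem_FP zRC_mem_FP)
/-- `zOff ∈ FP`. [cite: AroraBarak2009, §1.3] -/
private theorem zOff_mem_FP : zOff ∈ FP :=
  append_mem_FP (comp_mem_FP UnaryOffsets.mulLenFn_mem_FP (fanoutFn_mem_FP zMin_mem_FP zM_mem_FP))
    zMax_mem_FP
/-- `zBit ∈ FP`. [cite: AroraBarak2009, §1.3] -/
private theorem zBit_mem_FP : zBit ∈ FP := comp_mem_FP bitAtFn_mem_FP (fanoutFn_mem_FP zOff_mem_FP zU_mem_FP)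
/-- `pieceFn ∈ FP`. [cite: AroraBarak2009, §1.3] -/
private theorem pieceFn_mem_FP : pieceFn ∈ FP :=
  iteFn_mem_FP zDiag_mem_FP (const_mem_FP _) (notFn_mem_FP zBit_mem_FP)

/-- **`cleanFn ∈ FP`.** [cite: AroraBarak2009, §1.3 (bounded loops)] -/
theorem cleanFn_mem_FP : cleanFn ∈ FP :=
  comp_mem_FP (foldCat_mem_FP 1 X pieceFn_mem_FP)
    (fanoutFn_mem_FP (fanoutFn_mem_FP OracleCompose.id_mem_FP
      (comp_mem_FP binToUnaryFn_mem_FP (fanoutFn_mem_FP OracleCompose.id_mem_FP isqrtFn_mem_FP)))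
      OracleCompose.id_mem_FP)

/-- The piece record `⟨⟨u, 1ᵐ⟩, 1ᵗ⟩`. [folklore] -/
private def rec (u : List Bool) (m t : ℕ) : List Bool := boolPair (boolPair u (ones m)) (ones t)

/-- `zU` of a piece record. [folklore] -/
@[simp] private theorem zU_rec (u : List Bool) (m t : ℕ) : zU (rec u m t) = u := by simp [zU, rec]
/-- `zM` of a piece record. [folklore] -/
@[simp] private theorem zM_rec (u : List Bool) (m t : ℕ) : zM (rec u m t) = ones m := by simp [zM, rec]
/-- `zT` of a piece record. [folklore] -/
@[simp] private theorem zT_rec (u : List Bool) (m t : ℕ) : zT (rec u m t) = ones t := by simp [zT, rec]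

/-- `zRC` of a piece record: `⟨1^{t / m}, 1^{t mod m}⟩`. [folklore] -/
@[simp] private theorem zRC_rec (u : List Bool) (m t : ℕ) :
    zRC (rec u m t) = boolPair (ones (t / m)) (ones (t % m)) := by
  simp only [zRC, Function.comp_apply, fanoutFn_apply, zM_rec, zT_rec]
  exact Plumb.divModFn_boolPair m t

/-- `zR` of a piece record: `1^{t / m}`. [folklore] -/
@[simp] private theorem zR_rec (u : List Bool) (m t : ℕ) : zR (rec u m t) = ones (t / m) := by simp [zR]

/-- `zDiag` of a piece record: the diagonal test. [folklore] -/
@[simp] private theorem zDiag_rec (u : List Bool) (m t : ℕ) :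
    zDiag (rec u m t) = [decide (t / m = t % m)] := by
  simp only [zDiag, Function.comp_apply, zRC_rec, eqPairFn_boolPair]
  by_cases h : t / m = t % m
  · simp [h]
  · simp [h, ones, List.replicate_inj]

/-- `zDiag` is one-bit valued. [folklore] -/
private theorem oneBit_zDiag : OneBit zDiag := fun z => by
  rcases eqPairFn_eq_or (zRC z) with h | h <;> exact ⟨_, h⟩

/-- `|zMin| = min (t / m) (t mod m)` on a piece record. [folklore] -/
@[simp] private theorem length_zMin_rec (u : List Bool) (m t : ℕ) :
    (zMin (rec u m t)).length = min (t / m) (t % m) := by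
  simp [zMin, ones, List.take_replicate]

/-- `|zMax| = max (t / m) (t mod m)` on a piece record. [folklore] -/
@[simp] private theorem length_zMax_rec (u : List Bool) (m t : ℕ) :
    (zMax (rec u m t)).length = max (t / m) (t % m) := by
  simp [zMax, ones, List.drop_replicate]; omega

/-- `|zOff| = min · m + max` on a piece record. [folklore] -/
@[simp] private theorem length_zOff_rec (u : List Bool) (m t : ℕ) :
    (zOff (rec u m t)).length = min (t / m) (t % m) * m + max (t / m) (t % m) := by
  simp only [zOff, Function.comp_apply, fanoutFn_apply, List.length_append,
    UnaryOffsets.length_mulLenFn, length_zMin_rec, zM_rec, length_zMax_rec]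
  simp [ones]

/-- `zBit` of a piece record reads the upper-triangle entry. [folklore] -/
@[simp] private theorem zBit_rec (u : List Bool) (m t : ℕ) :
    zBit (rec u m t) = (u.drop (min (t / m) (t % m) * m + max (t / m) (t % m))).take 1 := by
  simp only [zBit, Function.comp_apply, fanoutFn_apply, zU_rec, bitAtFn_boolPair, length_zOff_rec]

/-- `take 1 ∘ drop t` inside the string is the singleton of the entry. [folklore] -/
private theorem take_one_drop_eq {u : List Bool} {t : ℕ} (h : t < u.length) :
    (u.drop t).take 1 = [u[t]] := by
  rw [List.take_one_drop_eq_of_lt_length h]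
  rfl

/-- **Value of the piece** on a square matrix, at an in-range position. [folklore] -/
private theorem pieceFn_rec {u : List Bool} {m t : ℕ} (hu : u.length = m * m) (ht : t < m * m) :
    pieceFn (rec u m t) = [entry u m t] := by
  rw [pieceFn, iteFn_of_oneBit oneBit_zDiag, zDiag_rec, entry]
  by_cases h : t / m = t % m
  · simp [h]
  · have h' := triPos_lt ht
    have h1 : zBit (rec u m t) = [u.getD (min (t / m) (t % m) * m + max (t / m) (t % m)) false] := by
      rw [zBit_rec, take_one_drop_eq (by omega), List.getD_eq_getElem _ _ (by omega)]
    rw [if_neg (by simp [h]), notFn_apply h1, if_neg h]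

/-- A concatenation of singletons is `List.ofFn`. [folklore] -/
private theorem ccat_eq_ofFn {g : ℕ → List Bool} : ∀ {k : ℕ} {b : Fin k → Bool},
    (∀ j : Fin k, g j = [b j]) → ccat g k = List.ofFn b
  | 0, _, _ => by simp
  | k + 1, b, h => by
    have hk : g k = [b (Fin.last k)] := h (Fin.last k)
    rw [ccat_succ, List.ofFn_succ', List.concat_eq_append,
      ccat_eq_ofFn (b := fun i : Fin k => b i.castSucc) (fun j => h j.castSucc), hk]

/-- **The cleaning brick on a square matrix**: `cleanFn u = (entry u m t)_{t < m²}` for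
`|u| = m²` — the row-major adjacency-matrix code (complemented, zero diagonal) of the graph on the
strict upper triangle of `u`. [Arora–Barak 2009, §0.1 (adjacency-matrix representation), §1.3]
[cite: AroraBarak2009, §0.1] -/
theorem cleanFn_sq {u : List Bool} {m : ℕ} (hu : u.length = m * m) :
    cleanFn u = List.ofFn fun t : Fin (m * m) => entry u m t := by
  have hrec : fanoutFn (fanoutFn id (binToUnaryFn ∘ fanoutFn id isqrtFn)) id u =
      boolPair (boolPair u (ones m)) u := by
    simp only [fanoutFn_apply, id, Function.comp_apply, isqrtFn_apply, binToUnaryFn_boolPair,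
      bitsToNat_encodeNat, hu, Nat.sqrt_eq, min_eq_left (Nat.le_mul_self m)]
  rw [cleanFn, Function.comp_apply, hrec, foldCat_apply]
  · rw [hu]
    exact ccat_eq_ofFn fun j => pieceFn_rec hu j.2
  · simp only [eval_X, length_boolPair]; omega
  · intro t ht
    rw [show boolPair (boolPair u (ones m)) (ones t) = rec u m t from rfl,
      pieceFn_rec hu (hu ▸ ht)]
    simp

end

end UpperTriangle

end Literature.Computability.Complexity
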